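import Summits.ABC.IUTFork.Conditional.AbcOfS
import Summits.ABC.IUTFork.Charitable.Thm311D1Derive
import Summits.ABC.IUTFork.Charitable.Thm311D2Derive
import HarnessLib

/-!
# Block D × branch C junction, teams D1 and D2: the C certificate `abc_of_S_v2` with its [S] binder DISCHARGED by
# `Thm311Charitable_1` / `Thm311Charitable_2` (the twins of `abc_of_charitable_3` / `abc_of_charitable_4`)

Proof-only file (D-0012) of the abc-iut cell, block D (maximally-charitable re-typings of [IUTchIII] Thm. 3.11); rung LADDER-ABC:A2.D
(junction with A2.C). Written post-lift by seat abc-iut-D3-typ (team D3 anchor, gen 3) under a first-refusal offer to the D1/D2 seats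
(STATUS 2026-08-26T10:2xZ), so that the §L fold can cite ONE junction theorem per charitable reading k = 1, 2, 3, 4. TAKES NO SIDE on
[IUTchIII] Cor. 3.12 or on any team's reading. NO definition, NO `Prop` fact. TWO theorems, purely compositional over LANDED files:
abc-iut-C-cert-1's `Summit.ABC.IUTFork.Conditional.abc_of_S_v2` (Conditional/AbcOfS.lean) and the pin-free block-D derivations
`Summit.ABC.IUTFork.Charitable.D1.S_of_perm_of_linkKummer` (abc-iut-D1-prv, Charitable/Thm311D1Derive.lean p428642/p428777, over
abc-iut-D1-typ's `D1.Thm311Charitable_1` p428378/p429129) and `Summit.ABC.IUTFork.Charitable.D2.pilotKummerIndRelated_of_charitable_2'`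
(abc-iut-D2-prv, Charitable/Thm311D2Derive.lean p428699/p429322, over abc-iut-D2-typ's `D2.Thm311Charitable_2` p428473/p429714) — consumed
BY NAME, nothing restated. Twins: `D3Derive.abc_of_charitable_3` (Thm311D3AbcOfCharitable.lean, p437294) and `D4Derive.abc_of_charitable_4`
(Thm311D4AbcOfCharitable.lean). S. Mochizuki, *Inter-universal Teichmüller theory III/IV* (kurims, May 2020); [claim: Mochizuki2012, status: disputed].

WHAT THE THEOREMS SAY — and what they do NOT. Each is `abc_of_S_v2` with the hypothesis [S] REPLACED by [CHAR] = «team Dk's charitable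
Theorem 3.11 holds at every datum» (k = 1: `D1.Thm311Charitable_1 (F P l T) (P312 P l T) (qK P l T)`; k = 2: `D2.Thm311Charitable_2 (F P l T)
(P312 P l T).n (qK P l T)`) and the C312 cone binder `hKumB` ((ii)(b) at column `n`) ABSORBED from the reading's own Part (ii) conjunct
(D1 `PartII.splitting`, D2 `II_b_SplittingKummer`); every other binder of the C certificate is carried VERBATIM ([PIN] two region pins at
`qK` + `BridgeHyps`; [CONE] `hvol`; [READ] `hΘ`, `hq`). Explicit `Prop` binders: CHAR 1 · PIN 2 · FACT 0 · CONE 1 · READ 2 = 6 each.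
So, IN KERNEL and ONLY conditionally: «`ABC` follows from team Dk's maximally-charitable reading of [IUTchIII] Thm. 3.11 + the
Corollary's pins + the bridge hypotheses + the campaign-S hull-volume node + the two reading equations, as typed». NOT a proof of abc,
NOT an endorsement of either reading — both load-bearing clauses (D1 `PartIII.linkKummer`, D2 `III_c_KummerLinkSquare`) are graded
STRONGER-THAN-PRINT by the block-D referees (D-ref §L v2, 2026-08-26T08:43:24Z) and are false at every honest pin-respecting carrier
(`D1.charitable_1_false_of_honest`, `D2.not_charitable_2`) —; typed ≠ proved; locates / conditionally verifies; no abc claim.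
-/

noncomputable section

namespace Summit.ABC.IUTFork.Charitable.AbcOfCharitable

open Thm311 Cor312 Cor312Vol Literature.IUT.LogThetaLattice
open Literature.IUT.LogVolume Literature.NumberTheory.DiophantineGeometry.GenEll Summit.ABC.ABC.Theorems

/-- **`abc_of_charitable_1` — branch C's certificate `abc_of_S_v2` with [S] discharged by team D1's charitable Theorem 3.11.** Per
`λ`-line point `P`, prime `l` and genuine Θ-volume datum `T`: [CHAR] `hChar` = `D1.Thm311Charitable_1 (F P l T) (P312 P l T) (qK P l T)` ·
[PIN] two region pins for `qK` + `BridgeHyps` · [CONE] `hvol` · [READ] `hΘ`, `hq`. Route: abc-iut-D1-prv's `D1.S_of_perm_of_linkKummer`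
(clauses I-perm + III-c-L2; no pin, no Part (ii) clause) supplies [S]; the reading's `PartII.splitting` conjunct supplies (ii)(b) at
column `n` (`D1.splitting_iff_kummerB` is `Iff.rfl`). CONDITIONAL; no side taken. [claim: Mochizuki2012, status: disputed] -/
theorem abc_of_charitable_1
    -- DATA (uncounted)
    {TI : ∀ (P : NFPoint) (l : ℕ), Cor22.ThetaVolumeDatumAt P l → ThetaIndex}
    (F : ∀ (P : NFPoint) (l : ℕ) (T : Cor22.ThetaVolumeDatumAt P l), LatticeSituation (TI P l T))
    (P312 : ∀ (P : NFPoint) (l : ℕ) (T : Cor22.ThetaVolumeDatumAt P l), Cor312.Setting (F P l T).toSituation)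
    (ρ : ∀ (P : NFPoint) (l : ℕ) (T : Cor22.ThetaVolumeDatumAt P l),
      (∀ v : (TI P l T).V, v ∈ (TI P l T).Vbad → Set ((F P l T).L.StarPacket v)) →
        ∀ (j : (TI P l T).Label) (vQ : (TI P l T).VQ), Set ((F P l T).L.Packet j vQ))
    (qK : ∀ (P : NFPoint) (l : ℕ) (T : Cor22.ThetaVolumeDatumAt P l),
      ∀ v : (TI P l T).V, v ∈ (TI P l T).Vbad → Set ((F P l T).L.StarPacket v))
    -- [CHAR] team D1's maximally-charitable Theorem 3.11 at every datum
    (hChar : ∀ P l T, D1.Thm311Charitable_1 (F P l T) (P312 P l T) (qK P l T))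
    -- [PIN] the Corollary's two region pins for the q-datum `qK`, and the bridge hypotheses
    (hPin : ∀ P l T, Cor312Vol.PinnedRegions (F P l T) (P312 P l T) (ρ P l T) (qK P l T))
    (hBridge : ∀ P l T, Cor312Vol.BridgeHyps (P312 P l T))
    -- [FACT] (none)
    -- [CONE] (ii′) the hull-volume estimate at the genuine data (campaign S); (ii)(b) is inside [CHAR]
    (hvol : ∀ P : NFPoint, P ∈ UP → ∀ l : ℕ, l.Prime → 5 ≤ l →
      Cor22.AdmitsCore P → Cor22.CondP2 P l → Cor22.CondP5 P l → Cor22.CondP6 P l →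
        Cor22.HullVolumeAtDatum P l (((l : ℝ) + 1) / 4 *
          ((1 + 12 * (Cor22.dmod P : ℝ) / l) * (P.logDiff + Cor22.logCondAvoid P {2, l})
            + 2 * Real.log l + 52
            + 20 / 3 * Real.log (((2 ^ 12 * 3 ^ 3 * 5 * Cor22.dmod P : ℕ) : ℝ) * (l : ℝ))
              * (Nat.primeCounting (2 ^ 12 * 3 ^ 3 * 5 * Cor22.dmod P * l) : ℝ))))
    -- [READ] the setting's two numbers are the datum's defined numbers
    (hΘ : ∀ P l T (x : ℝ), (P312 P l T).negLogTheta = (x : WithTop ℝ) → T.negLogTheta = x)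
    (hq : ∀ P l T, (P312 P l T).negLogQ = T.negAbsLogQ) :
    _root_.ABC :=
  Conditional.abc_of_S_v2 F P312 ρ qK
    (fun P l T => D1.S_of_perm_of_linkKummer (F P l T) (P312 P l T) (ρ P l T) (qK P l T) (hChar P l T).1.1 (hChar P l T).2.2.1)
    hPin hBridge (fun P l T => (hChar P l T).2.1.2.1 (P312 P l T).n) hvol hΘ hq

/-- **`abc_of_charitable_2` — branch C's certificate `abc_of_S_v2` with [S] discharged by team D2's charitable Theorem 3.11.** Per
`λ`-line point `P`, prime `l` and genuine Θ-volume datum `T`: [CHAR] `hChar` = `D2.Thm311Charitable_2 (F P l T) (P312 P l T).n (qK P l T)`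
(the codomain column of the reading is the setting's) · [PIN] two region pins for `qK` + `BridgeHyps` · [CONE] `hvol` · [READ] `hΘ`, `hq`.
Route: abc-iut-D2-prv's `D2.pilotKummerIndRelated_of_charitable_2'` (clauses I-perm + II-b + III-c-2; no pin) supplies [S]; the reading's
`II_b_SplittingKummer` conjunct supplies (ii)(b) at column `n` (`D2.kummerB_of_II_b`). CONDITIONAL; no side taken.
[claim: Mochizuki2012, status: disputed] -/
theorem abc_of_charitable_2
    -- DATA (uncounted)
    {TI : ∀ (P : NFPoint) (l : ℕ), Cor22.ThetaVolumeDatumAt P l → ThetaIndex}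
    (F : ∀ (P : NFPoint) (l : ℕ) (T : Cor22.ThetaVolumeDatumAt P l), LatticeSituation (TI P l T))
    (P312 : ∀ (P : NFPoint) (l : ℕ) (T : Cor22.ThetaVolumeDatumAt P l), Cor312.Setting (F P l T).toSituation)
    (ρ : ∀ (P : NFPoint) (l : ℕ) (T : Cor22.ThetaVolumeDatumAt P l),
      (∀ v : (TI P l T).V, v ∈ (TI P l T).Vbad → Set ((F P l T).L.StarPacket v)) →
        ∀ (j : (TI P l T).Label) (vQ : (TI P l T).VQ), Set ((F P l T).L.Packet j vQ))
    (qK : ∀ (P : NFPoint) (l : ℕ) (T : Cor22.ThetaVolumeDatumAt P l),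
      ∀ v : (TI P l T).V, v ∈ (TI P l T).Vbad → Set ((F P l T).L.StarPacket v))
    -- [CHAR] team D2's maximally-charitable Theorem 3.11 at every datum (codomain column = the setting's)
    (hChar : ∀ P l T, D2.Thm311Charitable_2 (F P l T) (P312 P l T).n (qK P l T))
    -- [PIN] the Corollary's two region pins for the q-datum `qK`, and the bridge hypotheses
    (hPin : ∀ P l T, Cor312Vol.PinnedRegions (F P l T) (P312 P l T) (ρ P l T) (qK P l T))
    (hBridge : ∀ P l T, Cor312Vol.BridgeHyps (P312 P l T))
    -- [FACT] (none)
    -- [CONE] (ii′) the hull-volume estimate at the genuine data (campaign S); (ii)(b) is inside [CHAR]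
    (hvol : ∀ P : NFPoint, P ∈ UP → ∀ l : ℕ, l.Prime → 5 ≤ l →
      Cor22.AdmitsCore P → Cor22.CondP2 P l → Cor22.CondP5 P l → Cor22.CondP6 P l →
        Cor22.HullVolumeAtDatum P l (((l : ℝ) + 1) / 4 *
          ((1 + 12 * (Cor22.dmod P : ℝ) / l) * (P.logDiff + Cor22.logCondAvoid P {2, l})
            + 2 * Real.log l + 52
            + 20 / 3 * Real.log (((2 ^ 12 * 3 ^ 3 * 5 * Cor22.dmod P : ℕ) : ℝ) * (l : ℝ))
              * (Nat.primeCounting (2 ^ 12 * 3 ^ 3 * 5 * Cor22.dmod P * l) : ℝ))))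
    -- [READ] the setting's two numbers are the datum's defined numbers
    (hΘ : ∀ P l T (x : ℝ), (P312 P l T).negLogTheta = (x : WithTop ℝ) → T.negLogTheta = x)
    (hq : ∀ P l T, (P312 P l T).negLogQ = T.negAbsLogQ) :
    _root_.ABC :=
  Conditional.abc_of_S_v2 F P312 ρ qK
    (fun P l T => D2.pilotKummerIndRelated_of_charitable_2' (F P l T) (P312 P l T) (ρ P l T) (qK P l T) (hChar P l T))
    hPin hBridge (fun P l T => D2.kummerB_of_II_b (F P l T) (hChar P l T).2.1.2.2.1 (P312 P l T).n) hvol hΘ hq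

end Summit.ABC.IUTFork.Charitable.AbcOfCharitable

end
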